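import Summits.QuantumFields.BalabanUV.T4Continuum.Support.NE7TorusChartDecoding
import Mathlib.Analysis.CStarAlgebra.Basic
import HarnessLib

/-!
# NE7DatumCoordinateStabiliser — THE `𝔲(n)` CHART COORDINATE OF A DATUM IS INVARIANT, IN NORM, UNDER THE GAUGE STABILISER OF THE BASE: for unitary `V₀`, a unitary site field
# `w` FIXING `V₀` (`V₀^{w} = V₀`) and any datum `V` bondwise within `1∕4` of `V₀` on the period box: `V^{w}` is bondwise exactly as close to `V₀` as `V`, and
# `‖skewPR N (relLog N V₀ (V^{w}))‖ = ‖skewPR N (relLog N V₀ V)‖` — the relative bond variables are CONJUGATED by the unitary `w(y + e_κ)`, and `log`, `skewP` and the C⋆-norm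
# are conjugation-equivariant ∕ invariant.  The brick that lets the two-sided Lipschitz bound of `A_k(V)` (ROAD-G113 §5ter) be stated in the coordinate `‖y(V)‖` although the
# minimiser over `V` is localised near `U♯` only MODULO the stabiliser of `V₀`

Cell `pub-balaban`, rung (B)+1 sub-cell t4, lineage `b2b-balaban-t4-ne7-p1` (CRUX PROVER NE7 #1 = OWNER of BINDER row NE7), generation 113.  Memo
`t4/b2b-balaban-t4-ne7-p1-g113/ROAD-G113.md` §5ter.  Over [tree] `MatrixLog.hasSum_mlog` (the logarithmic series), Mathlib's `CStarRing.norm_mem_unitary_mul` ∕ `norm_mul_mem_unitary`,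
`Units.conj_pow`, `ContinuousLinearMap.mulLeftRight`.
WHAT ([folklore]; 0 def, 0 sorry; generic `d`).  `norm_conj_unitary` (‖cYc⁻¹‖ = ‖Y‖; `W⁻¹ = W⋆` is [tree] `T4TermwiseUN.val_inv_eq_star`, inlined), `mlog_conj_unitary` (log(cZc⁻¹) = c·log Z·c⁻¹ for ‖Z − 1‖ < 1), `skewP_conj_unitary`,
`relVal_gaugeAct_stab` (the relative bond variable of `V^{w}` is the conjugate of that of `V` when `w` fixes `V₀`), **`near_gaugeAct_stab`**, **`norm_skewPR_relLog_gaugeAct_stab`**.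
HONEST FRAMING (page 1): elementary matrix algebra; nothing is asserted about Bałaban's minimisers; NOT NE7, NOT NE3; spine 0∕9; finite T⁴ rung (B)+1 — NOT infinite volume, NOT mass gap,
NOT BetaPertH, NOT Clay (continuum YM on T⁴ ⇐ BetaPertH ∧ nine spine estimates).
-/

set_option autoImplicit false

open scoped BigOperators Matrix Matrix.Norms.L2Operator Topology
open NormedSpace Finset Set Filter

namespace Summit.QuantumFields.BalabanUV.T4Continuum.NE7DatumCoordinateStabiliser

open Literature.MathematicalPhysics.QuantumFieldTheory.Balaban1983to89
open B7Prop1Explicit B7Prop2Explicit MatrixLog UnitaryModel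
open Literature.Analysis.Complex (logSeriesCoeff)
open T4AveragingDeficitWall (IsUnitaryCfg)
open AveragingDeficitTorusChart (TDir chart skewP skewP_apply)
open AveragingDeficitChartCalculus (relLog)
open AveragingDeficitTwoLevelPrep (skewSub skewPF skewPR skewPF_apply)

noncomputable section

variable {d : ℕ} {n : Type*} [Fintype n] [DecidableEq n]

/-! ## §1 Conjugation by a unitary: norm, logarithm, skew part -/

/-- The inverse of a unitary unit is unitary (as an algebra element). [folklore] -/
theorem inv_mem_unitary {c : (Matrix n n ℂ)ˣ} (hc : c ∈ unitaryUnits (Matrix n n ℂ)) : ((c⁻¹ : (Matrix n n ℂ)ˣ) : Matrix n n ℂ) ∈ unitary (Matrix n n ℂ) :=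
  mem_unitaryUnits.mp ((unitaryUnits _).inv_mem hc)

/-- `‖c·Y·c⁻¹‖ = ‖Y‖` for a unitary `c` (C⋆-norm). [folklore] -/
theorem norm_conj_unitary [Nonempty n] {c : (Matrix n n ℂ)ˣ} (hc : c ∈ unitaryUnits (Matrix n n ℂ)) (Y : Matrix n n ℂ) :
    ‖(c : Matrix n n ℂ) * Y * ((c⁻¹ : (Matrix n n ℂ)ˣ) : Matrix n n ℂ)‖ = ‖Y‖ := by
  letI : CStarAlgebra (Matrix n n ℂ) := {}
  rw [CStarRing.norm_mul_mem_unitary _ (inv_mem_unitary hc), CStarRing.norm_mem_unitary_mul _ (mem_unitaryUnits.mp hc)]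

/-- **`log(c Z c⁻¹) = c (log Z) c⁻¹`** for a unitary `c` and `‖Z − 1‖ < 1` (the logarithmic series termwise, `(cXc⁻¹)^k = cX^kc⁻¹`). [folklore] -/
theorem mlog_conj_unitary [Nonempty n] {c : (Matrix n n ℂ)ˣ} (hc : c ∈ unitaryUnits (Matrix n n ℂ)) {Z : Matrix n n ℂ} (hZ : ‖Z - 1‖ < 1) :
    mlog ((c : Matrix n n ℂ) * Z * ((c⁻¹ : (Matrix n n ℂ)ˣ) : Matrix n n ℂ)) = (c : Matrix n n ℂ) * mlog Z * ((c⁻¹ : (Matrix n n ℂ)ˣ) : Matrix n n ℂ) := by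
  letI : CStarAlgebra (Matrix n n ℂ) := {}
  set T : Matrix n n ℂ →L[ℂ] Matrix n n ℂ := ContinuousLinearMap.mulLeftRight ℂ (Matrix n n ℂ) (c : Matrix n n ℂ) ((c⁻¹ : (Matrix n n ℂ)ˣ) : Matrix n n ℂ) with hT
  have hT' : ∀ Y : Matrix n n ℂ, T Y = (c : Matrix n n ℂ) * Y * ((c⁻¹ : (Matrix n n ℂ)ˣ) : Matrix n n ℂ) := fun Y => by
    rw [hT, ContinuousLinearMap.mulLeftRight_apply]
  -- the conjugated variable is within `1` of `1`
  have hsub : (c : Matrix n n ℂ) * Z * ((c⁻¹ : (Matrix n n ℂ)ˣ) : Matrix n n ℂ) - 1 = (c : Matrix n n ℂ) * (Z - 1) * ((c⁻¹ : (Matrix n n ℂ)ˣ) : Matrix n n ℂ) := by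
    rw [mul_sub, sub_mul, mul_one, Units.mul_inv]
  have hZ' : ‖(c : Matrix n n ℂ) * Z * ((c⁻¹ : (Matrix n n ℂ)ˣ) : Matrix n n ℂ) - 1‖ < 1 := by
    rw [hsub, norm_conj_unitary hc]; exact hZ
  -- the series for `log Z` mapped by `T`, term by term
  have h1 := (hasSum_mlog hZ).mapL T
  have hterm : (fun k : ℕ => T (logSeriesCoeff k • (Z - 1) ^ k))
      = fun k : ℕ => logSeriesCoeff k • ((c : Matrix n n ℂ) * Z * ((c⁻¹ : (Matrix n n ℂ)ˣ) : Matrix n n ℂ) - 1) ^ k := by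
    funext k
    rw [map_smul, hT', hsub, Units.conj_pow]
  rw [hterm, hT'] at h1
  exact (hasSum_mlog hZ').unique h1

/-- **`skewP(c Y c⁻¹) = c (skewP Y) c⁻¹`** for a unitary `c` (`(cYc⁻¹)† = cY†c⁻¹`). [folklore] -/
theorem skewP_conj_unitary {c : (Matrix n n ℂ)ˣ} (hc : c ∈ unitaryUnits (Matrix n n ℂ)) (Y : Matrix n n ℂ) :
    skewP ((c : Matrix n n ℂ) * Y * ((c⁻¹ : (Matrix n n ℂ)ˣ) : Matrix n n ℂ)) = (c : Matrix n n ℂ) * skewP Y * ((c⁻¹ : (Matrix n n ℂ)ˣ) : Matrix n n ℂ) := by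
  have hinv : ((c⁻¹ : (Matrix n n ℂ)ˣ) : Matrix n n ℂ) = star (c : Matrix n n ℂ) :=
    Units.inv_eq_of_mul_eq_one_left (Unitary.star_mul_self_of_mem (mem_unitaryUnits.mp hc))
  have hstar : star ((c : Matrix n n ℂ) * Y * ((c⁻¹ : (Matrix n n ℂ)ˣ) : Matrix n n ℂ))
      = (c : Matrix n n ℂ) * star Y * ((c⁻¹ : (Matrix n n ℂ)ˣ) : Matrix n n ℂ) := by
    rw [hinv, star_mul, star_mul, star_star, mul_assoc]
  rw [skewP_apply, skewP_apply, hstar, ← sub_mul, ← mul_sub, mul_smul_comm, smul_mul_assoc]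

/-! ## §2 The relative bond variables of `V^{w}` when `w` fixes the base -/

/-- **CONJUGATION OF THE RELATIVE BOND VARIABLE**: if `w(y)·V₀(y,κ)·w(y+e_κ)⁻¹ = V₀(y,κ)` then
`V₀(y,κ)⁻¹·(V^{w})(y,κ) = w(y+e_κ)·(V₀(y,κ)⁻¹V(y,κ))·w(y+e_κ)⁻¹`. [folklore] -/
theorem relVal_gaugeAct_stab (w : Site d → (Matrix n n ℂ)ˣ) (V₀ V : Site d → Fin d → (Matrix n n ℂ)ˣ) (y : Site d) (κ : Fin d)
    (hfix : gaugeAct w V₀ y κ = V₀ y κ) :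
    (V₀ y κ)⁻¹ * gaugeAct w V y κ = w (y + e κ) * ((V₀ y κ)⁻¹ * V y κ) * (w (y + e κ))⁻¹ := by
  have h : w y * V₀ y κ * (w (y + e κ))⁻¹ = V₀ y κ := hfix
  have hw : w y = V₀ y κ * w (y + e κ) * (V₀ y κ)⁻¹ := by
    calc w y = (w y * V₀ y κ * (w (y + e κ))⁻¹) * w (y + e κ) * (V₀ y κ)⁻¹ := by group
      _ = V₀ y κ * w (y + e κ) * (V₀ y κ)⁻¹ := by rw [h]
  show (V₀ y κ)⁻¹ * (w y * V y κ * (w (y + e κ))⁻¹) = w (y + e κ) * ((V₀ y κ)⁻¹ * V y κ) * (w (y + e κ))⁻¹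
  rw [hw]; group

/-- **`V^{w}` IS EXACTLY AS CLOSE TO `V₀` AS `V`** (bondwise, relative) when `w` is unitary and fixes `V₀`. [folklore] -/
theorem near_gaugeAct_stab [Nonempty n] {w : Site d → (Matrix n n ℂ)ˣ} (hw : ∀ z, w z ∈ unitaryUnits (Matrix n n ℂ)) {V₀ V : Site d → Fin d → (Matrix n n ℂ)ˣ}
    (hfix : gaugeAct w V₀ = V₀) (y : Site d) (κ : Fin d) :
    ‖(((V₀ y κ)⁻¹ : (Matrix n n ℂ)ˣ) : Matrix n n ℂ) * ((gaugeAct w V y κ : (Matrix n n ℂ)ˣ) : Matrix n n ℂ) - 1‖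
      = ‖(((V₀ y κ)⁻¹ : (Matrix n n ℂ)ˣ) : Matrix n n ℂ) * (V y κ : Matrix n n ℂ) - 1‖ := by
  have h := relVal_gaugeAct_stab w V₀ V y κ (by rw [hfix])
  have hval : (((V₀ y κ)⁻¹ : (Matrix n n ℂ)ˣ) : Matrix n n ℂ) * ((gaugeAct w V y κ : (Matrix n n ℂ)ˣ) : Matrix n n ℂ)
      = (w (y + e κ) : Matrix n n ℂ) * ((((V₀ y κ)⁻¹ : (Matrix n n ℂ)ˣ) : Matrix n n ℂ) * (V y κ : Matrix n n ℂ)) * (((w (y + e κ))⁻¹ : (Matrix n n ℂ)ˣ) : Matrix n n ℂ) := by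
    have h' := congrArg (fun u : (Matrix n n ℂ)ˣ => (u : Matrix n n ℂ)) h
    simpa only [Units.val_mul] using h'
  have hsub : (w (y + e κ) : Matrix n n ℂ) * ((((V₀ y κ)⁻¹ : (Matrix n n ℂ)ˣ) : Matrix n n ℂ) * (V y κ : Matrix n n ℂ)) * (((w (y + e κ))⁻¹ : (Matrix n n ℂ)ˣ) : Matrix n n ℂ) - 1
      = (w (y + e κ) : Matrix n n ℂ) * ((((V₀ y κ)⁻¹ : (Matrix n n ℂ)ˣ) : Matrix n n ℂ) * (V y κ : Matrix n n ℂ) - 1) * (((w (y + e κ))⁻¹ : (Matrix n n ℂ)ˣ) : Matrix n n ℂ) := by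
    rw [mul_sub, sub_mul, mul_one, Units.mul_inv]
  rw [hval, hsub, norm_conj_unitary (hw _)]

/-- **THE CHART COORDINATE OF THE DATUM IS STABILISER-INVARIANT IN NORM**: `w` unitary fixing `V₀`, `V` bondwise within `1∕4` of `V₀` on the period box ⟹
`‖skewPR N (relLog N V₀ (V^{w}))‖ = ‖skewPR N (relLog N V₀ V)‖`. [folklore] -/
theorem norm_skewPR_relLog_gaugeAct_stab [Nonempty n] {N : ℕ} [NeZero N] {w : Site d → (Matrix n n ℂ)ˣ} (hw : ∀ z, w z ∈ unitaryUnits (Matrix n n ℂ))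
    {V₀ V : Site d → Fin d → (Matrix n n ℂ)ˣ} (hfix : gaugeAct w V₀ = V₀)
    (hnear : ∀ (r : Fin d → Fin N) (κ : Fin d),
      ‖(((V₀ (boxVec N r) κ)⁻¹ : (Matrix n n ℂ)ˣ) : Matrix n n ℂ) * (V (boxVec N r) κ : Matrix n n ℂ) - 1‖ ≤ 1 / 4) :
    ‖(skewPR N (relLog N V₀ (gaugeAct w V)) : ↥(skewSub d n N))‖ = ‖(skewPR N (relLog N V₀ V) : ↥(skewSub d n N))‖ := by
  -- entrywise: the coordinates are conjugate, hence of equal norm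
  have hentry : ∀ (r : Fin d → Fin N) (κ : Fin d),
      ‖((skewPR N (relLog N V₀ (gaugeAct w V)) : ↥(skewSub d n N)) : TDir d n N) r κ‖ = ‖((skewPR N (relLog N V₀ V) : ↥(skewSub d n N)) : TDir d n N) r κ‖ := by
    intro r κ
    set y : Site d := boxVec N r with hy
    set c : (Matrix n n ℂ)ˣ := w (y + e κ) with hc
    set Z : Matrix n n ℂ := (((V₀ y κ)⁻¹ : (Matrix n n ℂ)ˣ) : Matrix n n ℂ) * (V y κ : Matrix n n ℂ) with hZ
    have hZ1 : ‖Z - 1‖ < 1 := by rw [hZ, hy]; exact (hnear r κ).trans_lt (by norm_num)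
    have h := relVal_gaugeAct_stab w V₀ V y κ (by rw [hfix])
    have hval : (((V₀ y κ)⁻¹ : (Matrix n n ℂ)ˣ) : Matrix n n ℂ) * ((gaugeAct w V y κ : (Matrix n n ℂ)ˣ) : Matrix n n ℂ)
        = (c : Matrix n n ℂ) * Z * ((c⁻¹ : (Matrix n n ℂ)ˣ) : Matrix n n ℂ) := by
      have h' := congrArg (fun u : (Matrix n n ℂ)ˣ => (u : Matrix n n ℂ)) h
      simpa only [Units.val_mul, hc, hZ] using h'
    have e1 : ((skewPR N (relLog N V₀ (gaugeAct w V)) : ↥(skewSub d n N)) : TDir d n N) r κ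
        = skewP (mlog ((((V₀ y κ)⁻¹ : (Matrix n n ℂ)ˣ) : Matrix n n ℂ) * ((gaugeAct w V y κ : (Matrix n n ℂ)ˣ) : Matrix n n ℂ))) := by
      simp only [skewPR, ContinuousLinearMap.coe_codRestrict_apply, skewPF_apply, relLog, hy]
    have e2 : ((skewPR N (relLog N V₀ V) : ↥(skewSub d n N)) : TDir d n N) r κ = skewP (mlog Z) := by
      simp only [skewPR, ContinuousLinearMap.coe_codRestrict_apply, skewPF_apply, relLog, hZ, hy]
    rw [e1, e2, hval, mlog_conj_unitary (hw _) hZ1, skewP_conj_unitary (hw _), norm_conj_unitary (hw _)]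
  -- sup norms over the torus bonds agree
  rw [Submodule.coe_norm, Submodule.coe_norm]
  apply le_antisymm
  · refine (pi_norm_le_iff_of_nonneg (norm_nonneg _)).mpr fun r => (pi_norm_le_iff_of_nonneg (norm_nonneg _)).mpr fun κ => ?_
    rw [hentry r κ]
    exact (norm_le_pi_norm _ κ).trans (norm_le_pi_norm _ r)
  · refine (pi_norm_le_iff_of_nonneg (norm_nonneg _)).mpr fun r => (pi_norm_le_iff_of_nonneg (norm_nonneg _)).mpr fun κ => ?_
    rw [← hentry r κ]
    exact (norm_le_pi_norm _ κ).trans (norm_le_pi_norm _ r)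

end

end Summit.QuantumFields.BalabanUV.T4Continuum.NE7DatumCoordinateStabiliser
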